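import Summits.HubbardSuperconductivity.HubbardSuperconductivity.Theorems.AnisotropyChordTransferFibre3Cs2Fold

/-!
# Route `AnisotropyChord` / H0 rotor rung: (KT-2b-cs2) — the row estimates of memo 21 §304(c)

For THEOREM (KT-2b-cs2) (`Cs2RealSpaceBound`, PartN32; theory seat `hubbard-h0-rotor-theory-1`), after the fold `cs2 = Σ_{(a,b)∉D} d₊(a)²|A₊(a,b)|²`:
* `∇ₓ` bookkeeping: off `{0, x̂}` `R(b) = (∇ₓf(b))²` (`Rwt_eq_gradx_sq`); `‖∇ₓf‖² = R̄ + 2f_nn²` (`sum_gradx_sq`);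
* the CONTACT ROW `a = x̂`: `A₊(x̂,b) = −½w₊(f(b)+f(b−x̂))∇ₓf(b)` exactly (`Aplus_contact`, the blocked hop `w₋e^{iθ} = −w₊`), hence
  `Σ_b 1_{Dᶜ} d₊(x̂)²|A₊(x̂,b)|² ≤ 2ε₁ f_nn² M² R̄` (`contact_row_le`);
* the GENERIC ROW: `A₊ = α̃(a)P₁ + Z` (`Aplus_decomp`) with `α̃ = w₊ + w₋e^{iθaₓ}`, `|α̃(a)|² = 4ε₁(1 − cos θ(aₓ − 1))` (`normSq_alphaT`),
  `P₁ = f(b−a)f(b)`, `Σ_b P₁² ≤ Q₀` (`sum_P1_sq_le`), `|Z|² ≤ ε₁M²[(∇ₓf(b))² + (∇ₓf(b−a+x̂))²]` and `Σ_b |Z|² ≤ ε₁Γ_M` (`sum_normSq_Z_le`).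
Prover seat `hubbard-h0-rotor-p1` g22; helper for stmt-HubbardSuperconductivity-19089 (`--supports`).
-/

set_option linter.dupNamespace false
set_option autoImplicit false

noncomputable section

open scoped BigOperators
open Complex

namespace Summit.HubbardSuperconductivity.HubbardSuperconductivity.Theorems.AnisotropyChord.Transfer.Fibre3

variable (L : ℕ) [NeZero L]

/-! ## `∇ₓ f` versus `R` -/

omit [NeZero L] in
/-- off `{0, x̂}`: `∇ₓ s = −∇ₓ f`. [folklore] -/
theorem gradx_sfun (Δ : ℝ) (f : Tor L → ℝ) {b : Tor L} (hb0 : b ≠ 0) (hb1 : b ≠ K1 L) :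
    gradx L (sfun L Δ f) b = -gradx L f b := by
  have hb1' : b - K1 L ≠ 0 := sub_ne_zero.mpr hb1
  unfold gradx sfun
  simp only [hb0, hb1', if_false]
  ring

omit [NeZero L] in
/-- off `{0, x̂}`: `R(b) = (∇ₓ f(b))²`. [folklore] -/
theorem Rwt_eq_gradx_sq (Δ : ℝ) (f : Tor L → ℝ) {b : Tor L} (hb0 : b ≠ 0) (hb1 : b ≠ K1 L) :
    Rwt L Δ f b = gradx L f b ^ 2 := by
  unfold Rwt
  rw [if_neg (by push Not; exact ⟨hb0, hb1⟩), gradx_sfun L Δ f hb0 hb1]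
  ring

omit [NeZero L] in
/-- `R ≥ 0`. [folklore] -/
theorem Rwt_nonneg (Δ : ℝ) (f : Tor L → ℝ) (b : Tor L) : 0 ≤ Rwt L Δ f b := by
  unfold Rwt; split_ifs
  · exact le_rfl
  · exact sq_nonneg _

/-- `R̄ ≥ 0`. [folklore] -/
theorem Rbar_nonneg (Δ : ℝ) (f : Tor L → ℝ) : 0 ≤ Rbar L Δ f :=
  Finset.sum_nonneg fun b _ => Rwt_nonneg L Δ f b

/-- `X ≥ 0`. [folklore] -/
theorem Xmom_nonneg (Δ : ℝ) (f : Tor L → ℝ) : 0 ≤ Xmom L Δ f :=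
  Finset.sum_nonneg fun b _ => mul_nonneg (Rwt_nonneg L Δ f b) (by linarith [Real.cos_le_one (2 * Real.pi * ((b.1.val : ℝ) - 1) / L)])

/-- `Q₀ ≥ 0`. [folklore] -/
theorem Q0_nonneg (f : Tor L → ℝ) : 0 ≤ Q0 L f :=
  Finset.sum_nonneg fun b _ => by positivity

omit [NeZero L] in
/-- pointwise: `(∇ₓf(b))² = R(b) + 1_{b=0}(∇ₓf)² + 1_{b=x̂}(∇ₓf)²` (`x̂ ≠ 0`). [folklore] -/
theorem gradx_sq_eq (Δ : ℝ) (f : Tor L → ℝ) (hK : K1 L ≠ 0) (b : Tor L) :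
    gradx L f b ^ 2 = Rwt L Δ f b + (if b = 0 then gradx L f b ^ 2 else 0) + (if b = K1 L then gradx L f b ^ 2 else 0) := by
  by_cases h0 : b = 0
  · subst h0
    have : (0 : Tor L) ≠ K1 L := fun h => hK h.symm
    simp [Rwt, this]
  · by_cases h1 : b = K1 L
    · subst h1
      simp [Rwt, h0]
    · rw [Rwt_eq_gradx_sq L Δ f h0 h1]; simp [h0, h1]

/-- `f(−x̂) = f_nn` for a two-magnon profile. [folklore] -/
theorem f_neg_K1 {Δ lam2 : ℝ} {f : Tor L → ℝ} (hf : IsTwoMagnon L Δ lam2 f) : f (-K1 L) = f (K1 L) :=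
  hf.2.1 _ (by rw [K1_eq_ex, ← neg_ex]; unfold nnList; simp)

/-- **`‖∇ₓ f‖² = R̄ + 2 f_nn²`** for a two-magnon profile (`L ≥ 2`). [folklore] -/
theorem sum_gradx_sq (hL : 2 ≤ L) {Δ lam2 : ℝ} {f : Tor L → ℝ} (hf : IsTwoMagnon L Δ lam2 f) :
    ∑ b : Tor L, gradx L f b ^ 2 = Rbar L Δ f + 2 * f (K1 L) ^ 2 := by
  have h0 : f 0 = 0 := hf.1
  have fm := f_neg_K1 L hf
  have hK := K1_ne_zero L hL
  rw [Finset.sum_congr rfl fun b _ => gradx_sq_eq L Δ f hK b, Finset.sum_add_distrib, Finset.sum_add_distrib,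
    Finset.sum_ite_eq' Finset.univ (0 : Tor L), Finset.sum_ite_eq' Finset.univ (K1 L)]
  simp only [Finset.mem_univ, if_true]
  unfold Rbar gradx
  simp only [sub_self, zero_sub, h0, fm]
  ring

/-- translation invariance of `‖∇ₓ f‖²`. [folklore] -/
theorem sum_gradx_sq_shift (f : Tor L → ℝ) (t : Tor L) :
    ∑ b : Tor L, gradx L f (b + t) ^ 2 = ∑ b : Tor L, gradx L f b ^ 2 :=
  Fintype.sum_equiv (Equiv.addRight t) _ _ (fun _ => rfl)

/-! ## The contact row `a = x̂` -/

/-- **the blocked hop:** `A₊(x̂, b) = −½ w₊ (f(b) + f(b−x̂)) ∇ₓf(b)`. [folklore] -/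
theorem Aplus_contact (f : Tor L → ℝ) (b : Tor L) :
    Aplus L f (K1 L, b) = -(1 / 2 : ℂ) * wplus L * (((f b + f (b - K1 L)) * gradx L f b : ℝ) : ℂ) := by
  have hpq := phase_mul_neg L (K1 L) (K1 L)
  unfold Aplus gradx wplus wminus
  simp only [sub_add_cancel]
  push_cast
  linear_combination (-(((f b : ℝ) : ℂ) * (((f b : ℝ) : ℂ) + ((f (b - K1 L) : ℝ) : ℂ)) / 2)) * hpq

/-- `|w₊|² = 2ε₁` (`L ≥ 2`). [folklore] -/
theorem normSq_wplus (hL : 2 ≤ L) : Complex.normSq (wplus L) = 2 * eps1 L := by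
  unfold wplus
  rw [← Complex.normSq_neg, neg_sub]
  exact normSq_phase_K1_ex L hL

/-- `|w₋|² = 2ε₁` (`L ≥ 2`). [folklore] -/
theorem normSq_wminus (hL : 2 ≤ L) : Complex.normSq (wminus L) = 2 * eps1 L := by
  unfold wminus
  rw [← Complex.normSq_neg, neg_sub, show -K1 L = -ex L from rfl]
  exact normSq_phase_K1_neg_ex L hL

/-- contact row, pointwise: `|A₊(x̂,b)|² ≤ 2ε₁M²(∇ₓf(b))²` for `|f| ≤ M`. [folklore] -/
theorem normSq_Aplus_contact_le (hL : 2 ≤ L) {f : Tor L → ℝ} {M : ℝ} (hM : ∀ r : Tor L, |f r| ≤ M) (b : Tor L) :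
    Complex.normSq (Aplus L f (K1 L, b)) ≤ 2 * eps1 L * M ^ 2 * gradx L f b ^ 2 := by
  rw [Aplus_contact, Complex.normSq_mul, Complex.normSq_mul, Complex.normSq_ofReal, normSq_wplus L hL,
    Complex.normSq_neg, show (1 / 2 : ℂ) = ((1 / 2 : ℝ) : ℂ) by push_cast; ring, Complex.normSq_ofReal]
  have h1 := hM b
  have h2 := hM (b - K1 L)
  have hε : 0 ≤ eps1 L := by unfold eps1; linarith [Real.cos_le_one (2 * Real.pi / L)]
  have hs : (f b + f (b - K1 L)) ^ 2 ≤ (2 * M) ^ 2 := by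
    have := abs_add_le (f b) (f (b - K1 L))
    have hM0 : 0 ≤ M := (abs_nonneg _).trans h1
    nlinarith [abs_nonneg (f b + f (b - K1 L)), sq_abs (f b + f (b - K1 L))]
  have hg : 0 ≤ gradx L f b ^ 2 := sq_nonneg _
  nlinarith [mul_le_mul_of_nonneg_right hs (mul_nonneg hε hg)]

/-- ★ **contact row:** `Σ_b 1_{Dᶜ}(x̂,b) d₊(x̂)²|A₊(x̂,b)|² ≤ 2ε₁ f_nn² M² R̄`. [folklore] -/
theorem contact_row_le (hL : 2 ≤ L) {Δ lam2 M : ℝ} {f : Tor L → ℝ} (hf : IsTwoMagnon L Δ lam2 f)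
    (hM : ∀ r : Tor L, |f r| ≤ M) :
    ∑ b : Tor L, cs2term L f (K1 L, b) ≤ 2 * eps1 L * f (K1 L) ^ 2 * M ^ 2 * Rbar L Δ f := by
  have h0 : f 0 = 0 := hf.1
  have hε : 0 ≤ eps1 L := by unfold eps1; linarith [Real.cos_le_one (2 * Real.pi / L)]
  unfold Rbar
  rw [Finset.mul_sum]
  apply Finset.sum_le_sum
  intro b _
  have hR := Rwt_nonneg L Δ f b
  unfold cs2term
  split_ifs with hD
  · positivity
  · -- off D: b ≠ 0, b ≠ x̂
    have hD' : InD L (K1 L, b) = false := by simpa using hD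
    unfold InD at hD'
    simp only [Bool.or_eq_false_iff, decide_eq_false_iff_not] at hD'
    obtain ⟨⟨-, hb0⟩, hb1⟩ := hD'
    have hb1' : b ≠ K1 L := fun h => hb1 h.symm
    simp only [sub_self, h0, sub_zero]
    have h := normSq_Aplus_contact_le L hL hM b
    rw [← Rwt_eq_gradx_sq L Δ f hb0 hb1'] at h
    have hf2 : 0 ≤ f (K1 L) ^ 2 := sq_nonneg _
    nlinarith [mul_le_mul_of_nonneg_left h hf2]

/-! ## The generic row -/

/-- `α̃(a) := w₊ + w₋ e^{iθaₓ}` (the `f ≡ 1` value of `A₊`). [folklore] -/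
def alphaT (a : Tor L) : ℂ := wplus L + wminus L * phase L (K1 L) a

/-- `P₁(a,b) := f(b−a) f(b)`. [folklore] -/
def P1 (f : Tor L → ℝ) (c : Cfg L) : ℝ := f (c.2 - c.1) * f c.2

/-- `Z(a,b) := ½w₊ f(b−a)(f(b−x̂) − f(b)) + ½w₋e^{iθaₓ} f(b)(f(b−a+x̂) − f(b−a))`. [folklore] -/
def Zterm (f : Tor L → ℝ) (c : Cfg L) : ℂ :=
  (1 / 2 : ℂ) * wplus L * ((f (c.2 - c.1) * (f (c.2 - K1 L) - f c.2) : ℝ) : ℂ)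
    + (1 / 2 : ℂ) * wminus L * phase L (K1 L) c.1 * ((f c.2 * (f (c.2 - c.1 + K1 L) - f (c.2 - c.1)) : ℝ) : ℂ)

omit [NeZero L] in
/-- **`A₊ = α̃ P₁ + Z`.** [folklore] -/
theorem Aplus_decomp (f : Tor L → ℝ) (c : Cfg L) :
    Aplus L f c = alphaT L c.1 * ((P1 L f c : ℝ) : ℂ) + Zterm L f c := by
  unfold Aplus alphaT P1 Zterm
  push_cast
  ring

/-- **`|α̃(a)|² = 4ε₁(1 − cos θ(aₓ − 1))`** (`L ≥ 2`). [folklore] -/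
theorem normSq_alphaT (hL : 2 ≤ L) (a : Tor L) :
    Complex.normSq (alphaT L a) = 4 * eps1 L * (1 - Real.cos (2 * Real.pi * ((a.1.val : ℝ) - 1) / L)) := by
  have : Fact (1 < L) := ⟨by omega⟩
  have hpq := phase_mul_neg L (K1 L) (K1 L)
  have hfac : alphaT L a = (1 - phase L (K1 L) (K1 L)) * (1 - phase L (K1 L) a * phase L (K1 L) (-(K1 L))) := by
    unfold alphaT wplus wminus
    linear_combination (-(phase L (K1 L) a)) * hpq
  have h1 : Complex.normSq (1 - phase L (K1 L) (K1 L)) = 2 * eps1 L := by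
    rw [← Complex.normSq_neg, neg_sub]
    exact normSq_phase_K1_ex L hL
  set x : ℝ := 2 * Real.pi * ((a.1.val : ℝ) - 1) / L with hx
  have h2 : phase L (K1 L) a * phase L (K1 L) (-(K1 L)) = Complex.exp ((x : ℂ) * Complex.I) := by
    rw [← conj_phase, phase_comm L (K1 L) a, show phase L a (K1 L) = phase L a (ex L) from rfl, phase_ex,
      show phase L (K1 L) (K1 L) = phase L (K1 L) (ex L) from rfl, phase_ex, ← Complex.exp_conj, ← Complex.exp_add]
    congr 1
    have hv : ((K1 L).1.val : ℕ) = 1 := by unfold K1; exact ZMod.val_one L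
    rw [hv, hx]
    simp only [map_mul, map_div₀, Complex.conj_ofReal, Complex.conj_I, map_natCast, map_ofNat, Nat.cast_one, map_one]
    push_cast
    ring
  rw [hfac, Complex.normSq_mul, h1, h2, Complex.normSq_apply, Complex.sub_re, Complex.sub_im, Complex.one_re,
    Complex.one_im, Complex.exp_ofReal_mul_I_re, Complex.exp_ofReal_mul_I_im]
  linear_combination (2 * eps1 L) * Real.sin_sq_add_cos_sq x

/-- `Σ_b P₁(a,b)² ≤ Q₀` (Cauchy–Schwarz). [folklore] -/
theorem sum_P1_sq_le (f : Tor L → ℝ) (a : Tor L) : ∑ b : Tor L, P1 L f (a, b) ^ 2 ≤ Q0 L f := by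
  unfold P1 Q0
  simp only
  have hcs := Real.sum_mul_le_sqrt_mul_sqrt Finset.univ (fun b : Tor L => f (b - a) ^ 2) (fun b : Tor L => f b ^ 2)
  have hshift : ∑ b : Tor L, (f (b - a) ^ 2) ^ 2 = ∑ b : Tor L, (f b ^ 2) ^ 2 :=
    Fintype.sum_equiv (Equiv.subRight a) _ _ (fun _ => rfl)
  rw [hshift] at hcs
  have hQ : 0 ≤ ∑ b : Tor L, (f b ^ 2) ^ 2 := Finset.sum_nonneg fun b _ => by positivity
  rw [Real.mul_self_sqrt hQ] at hcs
  calc ∑ b : Tor L, (f (b - a) * f b) ^ 2 = ∑ b : Tor L, f (b - a) ^ 2 * f b ^ 2 := by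
        refine Finset.sum_congr rfl fun b _ => ?_; ring
    _ ≤ ∑ b : Tor L, (f b ^ 2) ^ 2 := hcs
    _ = ∑ r : Tor L, f r ^ 4 := by refine Finset.sum_congr rfl fun b _ => ?_; ring

/-- `|Z(a,b)|² ≤ ε₁ M² [(∇ₓf(b))² + (∇ₓf(b−a+x̂))²]` for `|f| ≤ M` (`L ≥ 2`). [folklore] -/
theorem normSq_Z_le (hL : 2 ≤ L) {f : Tor L → ℝ} {M : ℝ} (hM : ∀ r : Tor L, |f r| ≤ M) (c : Cfg L) :
    Complex.normSq (Zterm L f c) ≤ eps1 L * M ^ 2 * (gradx L f c.2 ^ 2 + gradx L f (c.2 - c.1 + K1 L) ^ 2) := by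
  unfold Zterm
  set u : ℂ := (1 / 2 : ℂ) * wplus L * ((f (c.2 - c.1) * (f (c.2 - K1 L) - f c.2) : ℝ) : ℂ) with hu
  set v : ℂ := (1 / 2 : ℂ) * wminus L * phase L (K1 L) c.1 * ((f c.2 * (f (c.2 - c.1 + K1 L) - f (c.2 - c.1)) : ℝ) : ℂ)
    with hv
  have hpar : Complex.normSq (u + v) ≤ 2 * (Complex.normSq u + Complex.normSq v) := by
    have h : Complex.normSq (u + v) + Complex.normSq (u - v) = 2 * (Complex.normSq u + Complex.normSq v) := by
      rw [Complex.normSq_add, Complex.normSq_sub]; ring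
    linarith [Complex.normSq_nonneg (u - v)]
  have hhalf : Complex.normSq (1 / 2 : ℂ) = 1 / 4 := by
    rw [show (1 / 2 : ℂ) = ((1 / 2 : ℝ) : ℂ) by push_cast; ring, Complex.normSq_ofReal]; norm_num
  have hnu : Complex.normSq u = eps1 L / 2 * (f (c.2 - c.1) * (f (c.2 - K1 L) - f c.2)) ^ 2 := by
    rw [hu, Complex.normSq_mul, Complex.normSq_mul, hhalf, normSq_wplus L hL, Complex.normSq_ofReal]; ring
  have hnv : Complex.normSq v = eps1 L / 2 * (f c.2 * (f (c.2 - c.1 + K1 L) - f (c.2 - c.1))) ^ 2 := by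
    rw [hv, Complex.normSq_mul, Complex.normSq_mul, Complex.normSq_mul, hhalf, normSq_wminus L hL, normSq_phase,
      Complex.normSq_ofReal]; ring
  have hε : 0 ≤ eps1 L := by unfold eps1; linarith [Real.cos_le_one (2 * Real.pi / L)]
  have hM0 : 0 ≤ M := (abs_nonneg _).trans (hM 0)
  have hb1 : f (c.2 - c.1) ^ 2 ≤ M ^ 2 := by
    have := hM (c.2 - c.1); nlinarith [abs_nonneg (f (c.2 - c.1)), sq_abs (f (c.2 - c.1))]
  have hb2 : f c.2 ^ 2 ≤ M ^ 2 := by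
    have := hM c.2; nlinarith [abs_nonneg (f c.2), sq_abs (f c.2)]
  have hg1 : (f (c.2 - K1 L) - f c.2) ^ 2 = gradx L f c.2 ^ 2 := by unfold gradx; ring
  have hg2 : (f (c.2 - c.1 + K1 L) - f (c.2 - c.1)) ^ 2 = gradx L f (c.2 - c.1 + K1 L) ^ 2 := by
    unfold gradx; rw [add_sub_cancel_right]
  refine hpar.trans ?_
  rw [hnu, hnv, mul_pow, mul_pow, hg1, hg2]
  have hga : 0 ≤ gradx L f c.2 ^ 2 := sq_nonneg _
  have hgb : 0 ≤ gradx L f (c.2 - c.1 + K1 L) ^ 2 := sq_nonneg _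
  nlinarith [mul_le_mul_of_nonneg_right hb1 (mul_nonneg hε hga), mul_le_mul_of_nonneg_right hb2 (mul_nonneg hε hgb)]

/-- ★ **generic row:** `Σ_b |Z(a,b)|² ≤ ε₁ Γ_M` for a two-magnon profile with `|f| ≤ M` (`L ≥ 2`). [folklore] -/
theorem sum_normSq_Z_le (hL : 2 ≤ L) {Δ lam2 M : ℝ} {f : Tor L → ℝ} (hf : IsTwoMagnon L Δ lam2 f)
    (hM : ∀ r : Tor L, |f r| ≤ M) (a : Tor L) :
    ∑ b : Tor L, Complex.normSq (Zterm L f (a, b)) ≤ eps1 L * GammaM L Δ f M := by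
  have hsum := sum_gradx_sq L hL hf
  have hshift := sum_gradx_sq_shift L f (-a + K1 L)
  calc ∑ b : Tor L, Complex.normSq (Zterm L f (a, b))
      ≤ ∑ b : Tor L, eps1 L * M ^ 2 * (gradx L f b ^ 2 + gradx L f (b + (-a + K1 L)) ^ 2) := by
        refine Finset.sum_le_sum fun b _ => ?_
        have h := normSq_Z_le L hL hM (a, b)
        simp only at h
        rw [show b - a + K1 L = b + (-a + K1 L) by abel] at h
        exact h
    _ = eps1 L * M ^ 2 * (∑ b : Tor L, gradx L f b ^ 2 + ∑ b : Tor L, gradx L f (b + (-a + K1 L)) ^ 2) := by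
        rw [← Finset.mul_sum, Finset.sum_add_distrib]
    _ = eps1 L * GammaM L Δ f M := by
        rw [hshift, hsum]; unfold GammaM; ring

end Summit.HubbardSuperconductivity.HubbardSuperconductivity.Theorems.AnisotropyChord.Transfer.Fibre3

end
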